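import Mathlib
import HarnessLib
import Summits.HubbardSuperconductivity.HubbardSuperconductivity.Theorems.KLProgrammeKLRegimeTwoVolumeSubstitutionPushforward
import Literature.Probability.LatticeModels.SubmultiplicativeTreeWeight

/-!
# Route `KLProgramme` — crux K3, the nested two-volume pass: the DIAMETER-WEIGHTED pushforward of a profile through a linear substitution
# (weighted twin of `…TwoVolumeSubstitutionPushforward`; cell gate-hubbard-kl, seat hubbard-kl-k3c4-p1 g9; VL-INDUCTION-BLUEPRINT-g8.md (vi); `--supports` stmt-…-20440)

The two-volume STEP (`…TwoVolumeInductiveStep`) reads the `φ(diam)`-weighted all-degree profiles `NV`, `ND` of the incoming fine action and of its defect; the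
incoming action at scale `j+1` is the image `map (toLin' T′) 𝒲′` of the scale-`j` action under the re-sectorisation substitution `T′`.  This file bounds the
weighted profile of such an image by the weighted profile of `𝒲′` and the `φ`-WEIGHTED column sums / pin row of `T′`:

* `phi_add_sum_le_mul_prod` — sub-multiplicativity iterated: `φ(t + Σ_i a_i) ≤ φ(t)·Π_i φ(a_i)` (`t, a_i ≥ 0`, `φ ≥ 1` on `[0,∞)`);
* `labelDiam_image_le_labelDiam_image_add_sum` — geometry: with a cross-distance `dc` between out- and in-labels satisfying the cross-triangle inequality
  `d₂ x x̃ ≤ dc x y + d₁ y ỹ + dc x̃ ỹ`, `diam_{d₂}(X′) ≤ diam_{d₁}(Y′) + Σ_i dc (X′ i) (Y′ i)`;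
* `diamWeight_image_le_mul_prod` — hence `φ(diam_{d₂} X′) ≤ φ(diam_{d₁} Y′) · Π_i φ(dc (X′ i) (Y′ i))`;
* **`sum_pinned_wt_norm_kernel_map_le`** — `Σ_{X′ : X′_p = w′} ‖kernel (map T′ D) (n+1) X′‖·φ(diam_{d₂} X′) ≤ aφⁿ·aφ·N_D^φ` for `φ`-weighted column sums and pin
  row `≤ aφ` and `φ(diam_{d₁})`-weighted pinned profile `≤ N_D^φ`;
* `sum_pinned_wt_norm_kernel_map_le_of_near` — the near/far split of the pin row (`≤ aφ` near, `≤ τ` beyond): `≤ aφⁿ·(aφ·E^φ + τ·N_D^φ)`.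

In the model the in- and out-labels are `SpaceTimeIdx × SectorLeg N_j` / `× SectorLeg N_{j+1}`, all three distances are the site distance (label-blind), and the
cross-triangle inequality is the triangle inequality of the torus distance.  Generic; everything proved; no definition.
-/

noncomputable section

namespace Summit.HubbardSuperconductivity.HubbardSuperconductivity.Theorems.TwoVolumeDefect

set_option linter.dupNamespace false -- summit = problem name (single-conjunct summit), D-0017

open Finset Literature.MathematicalPhysics.QuantumLattice GrassmannAlgebra Literature.Probability.LatticeModels
  Literature.Probability.LatticeModels.BattleFederbush

/-! ## §1 Sub-multiplicativity iterated -/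

/-- **`φ(t + Σ_{i∈s} a_i) ≤ φ(t) · Π_{i∈s} φ(a_i)`** for `φ ≥ 1` on `[0,∞)` sub-multiplicative, `t ≥ 0`, `a_i ≥ 0`. [folklore] -/
theorem phi_add_sum_le_mul_prod {ι : Type*} [DecidableEq ι] {phi : ℝ → ℝ} (hphi1 : ∀ s, 0 ≤ s → 1 ≤ phi s)
    (hphisub : ∀ s t, 0 ≤ s → 0 ≤ t → phi (s + t) ≤ phi s * phi t) (s : Finset ι) {a : ι → ℝ} (ha : ∀ i ∈ s, 0 ≤ a i)
    {t : ℝ} (ht : 0 ≤ t) : phi (t + ∑ i ∈ s, a i) ≤ phi t * ∏ i ∈ s, phi (a i) := by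
  induction s using Finset.induction_on generalizing t with
  | empty => simp
  | @insert j s hj ih =>
    have ha' : ∀ i ∈ s, 0 ≤ a i := fun i hi => ha i (mem_insert_of_mem hi)
    have hj0 : 0 ≤ a j := ha j (mem_insert_self j s)
    have hs0 : 0 ≤ ∑ i ∈ s, a i := sum_nonneg ha'
    rw [sum_insert hj, prod_insert hj, ← add_assoc]
    have h1 : phi (t + a j + ∑ i ∈ s, a i) ≤ phi (t + a j) * ∏ i ∈ s, phi (a i) := ih ha' (add_nonneg ht hj0)
    have h2 : phi (t + a j) ≤ phi t * phi (a j) := hphisub t (a j) ht hj0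
    have hprod : 0 ≤ ∏ i ∈ s, phi (a i) := prod_nonneg fun i hi => zero_le_one.trans (hphi1 _ (ha' i hi))
    calc phi (t + a j + ∑ i ∈ s, a i) ≤ phi (t + a j) * ∏ i ∈ s, phi (a i) := h1
      _ ≤ (phi t * phi (a j)) * ∏ i ∈ s, phi (a i) := mul_le_mul_of_nonneg_right h2 hprod
      _ = phi t * (phi (a j) * ∏ i ∈ s, phi (a i)) := by ring

/-! ## §2 Geometry: the diameter of the out-tuple against the in-tuple -/

/-- **`diam_{d₂}(X′) ≤ diam_{d₁}(Y′) + Σ_i dc (X′ i) (Y′ i)`** under the cross-triangle inequality `d₂ x x̃ ≤ dc x y + d₁ y ỹ + dc x̃ ỹ` (`dc ≥ 0`,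
`d₂` a label pseudo-distance). [folklore] -/
theorem labelDiam_image_le_labelDiam_image_add_sum {Γ₁' Γ₂' : Type*} [DecidableEq Γ₁'] [DecidableEq Γ₂'] {d₁ : Γ₁' → Γ₁' → ℝ}
    {d₂ : Γ₂' → Γ₂' → ℝ} (hd₂ : IsLabelDist d₂) {dc : Γ₂' → Γ₁' → ℝ} (hdc0 : ∀ x y, 0 ≤ dc x y)
    (hcross : ∀ x x' y y', d₂ x x' ≤ dc x y + d₁ y y' + dc x' y') {m : ℕ} (X' : Fin m → Γ₂') (Y' : Fin m → Γ₁') :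
    labelDiam d₂ (univ.image X') ≤ labelDiam d₁ (univ.image Y') + ∑ i, dc (X' i) (Y' i) := by
  have hsum0 : 0 ≤ ∑ i, dc (X' i) (Y' i) := sum_nonneg fun i _ => hdc0 _ _
  refine labelDiam_le d₂ (add_nonneg (labelDiam_nonneg _ _) hsum0) fun a ha b hb => ?_
  obtain ⟨i, -, rfl⟩ := mem_image.1 ha
  obtain ⟨k, -, rfl⟩ := mem_image.1 hb
  by_cases hik : i = k
  · subst hik
    rw [hd₂.self]
    exact add_nonneg (labelDiam_nonneg _ _) hsum0
  · have hY : d₁ (Y' i) (Y' k) ≤ labelDiam d₁ (univ.image Y') :=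
      le_labelDiam d₁ (mem_image_of_mem _ (mem_univ i)) (mem_image_of_mem _ (mem_univ k))
    have hpair : dc (X' i) (Y' i) + dc (X' k) (Y' k) ≤ ∑ j, dc (X' j) (Y' j) := by
      rw [← sum_pair (f := fun j => dc (X' j) (Y' j)) hik]
      exact sum_le_sum_of_subset_of_nonneg (subset_univ _) fun j _ _ => hdc0 _ _
    calc d₂ (X' i) (X' k) ≤ dc (X' i) (Y' i) + d₁ (Y' i) (Y' k) + dc (X' k) (Y' k) := hcross _ _ _ _
      _ ≤ labelDiam d₁ (univ.image Y') + ∑ j, dc (X' j) (Y' j) := by linarith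

/-- **`φ(diam_{d₂} X′) ≤ φ(diam_{d₁} Y′) · Π_i φ(dc (X′ i) (Y′ i))`** (same geometry; `φ ≥ 1` monotone sub-multiplicative on `[0,∞)`). [folklore] -/
theorem diamWeight_image_le_mul_prod {Γ₁' Γ₂' : Type*} [DecidableEq Γ₁'] [DecidableEq Γ₂'] {d₁ : Γ₁' → Γ₁' → ℝ}
    {d₂ : Γ₂' → Γ₂' → ℝ} (hd₂ : IsLabelDist d₂) {dc : Γ₂' → Γ₁' → ℝ} (hdc0 : ∀ x y, 0 ≤ dc x y)
    (hcross : ∀ x x' y y', d₂ x x' ≤ dc x y + d₁ y y' + dc x' y') {phi : ℝ → ℝ} (hphi1 : ∀ s, 0 ≤ s → 1 ≤ phi s)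
    (hphimono : ∀ s t, 0 ≤ s → s ≤ t → phi s ≤ phi t) (hphisub : ∀ s t, 0 ≤ s → 0 ≤ t → phi (s + t) ≤ phi s * phi t)
    {m : ℕ} (X' : Fin m → Γ₂') (Y' : Fin m → Γ₁') :
    diamWeight phi d₂ (univ.image X') ≤ diamWeight phi d₁ (univ.image Y') * ∏ i, phi (dc (X' i) (Y' i)) := by
  unfold diamWeight
  calc phi (labelDiam d₂ (univ.image X')) ≤ phi (labelDiam d₁ (univ.image Y') + ∑ i, dc (X' i) (Y' i)) :=
        hphimono _ _ (labelDiam_nonneg _ _) (labelDiam_image_le_labelDiam_image_add_sum hd₂ hdc0 hcross X' Y')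
    _ ≤ phi (labelDiam d₁ (univ.image Y')) * ∏ i, phi (dc (X' i) (Y' i)) :=
        phi_add_sum_le_mul_prod hphi1 hphisub univ (fun i _ => hdc0 _ _) (labelDiam_nonneg _ _)

/-! ## §3 The weighted pushforward -/

variable {𝕜 : Type*} [RCLike 𝕜] {Γ₁' Γ₂' : Type*} [Fintype Γ₁'] [DecidableEq Γ₁'] [Fintype Γ₂'] [DecidableEq Γ₂']

/-- **THE DIAMETER-WEIGHTED PUSHFORWARD, with a near/far split of the pin row.**  Substitution `T′` with `φ(dc)`-weighted column sums `≤ a`, the pin's weighted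
row `≤ a` on near in-labels and `≤ τ` beyond; element `D` with `φ(diam_{d₁})`-weighted pinned profile `≤ E` at near in-labels and `≤ ND` everywhere (degree
`n+1`, leg `p`):  `Σ_{X′ : X′_p = w′} ‖kernel (map T′ D) (n+1) X′‖·φ(diam_{d₂} X′) ≤ aⁿ·(a·E + τ·ND)`. [folklore] -/
theorem sum_pinned_wt_norm_kernel_map_le_of_near (T' : Matrix Γ₂' Γ₁' 𝕜) (D : GrassmannAlgebra 𝕜 Γ₁') {n : ℕ} (p : Fin (n + 1)) (w' : Γ₂')
    {d₁ : Γ₁' → Γ₁' → ℝ} {d₂ : Γ₂' → Γ₂' → ℝ} (hd₂ : IsLabelDist d₂) {dc : Γ₂' → Γ₁' → ℝ} (hdc0 : ∀ x y, 0 ≤ dc x y)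
    (hcross : ∀ x x' y y', d₂ x x' ≤ dc x y + d₁ y y' + dc x' y') {phi : ℝ → ℝ} (hphi1 : ∀ s, 0 ≤ s → 1 ≤ phi s)
    (hphimono : ∀ s t, 0 ≤ s → s ≤ t → phi s ≤ phi t) (hphisub : ∀ s t, 0 ≤ s → 0 ≤ t → phi (s + t) ≤ phi s * phi t)
    (Near : Γ₁' → Prop) [DecidablePred Near] {a τ E ND : ℝ} (ha : 0 ≤ a) (hE0 : 0 ≤ E) (hND0 : 0 ≤ ND)
    (hcol : ∀ y', ∑ x', ‖T' x' y'‖ * phi (dc x' y') ≤ a)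
    (hrow : ∑ y' ∈ univ.filter (fun y' : Γ₁' => Near y'), ‖T' w' y'‖ * phi (dc w' y') ≤ a)
    (hτ : ∑ y' ∈ univ.filter (fun y' : Γ₁' => ¬ Near y'), ‖T' w' y'‖ * phi (dc w' y') ≤ τ)
    (hE : ∀ y', Near y' → ∑ Y' ∈ univ.filter (fun Y' : Fin (n + 1) → Γ₁' => Y' p = y'),
      ‖kernel 𝕜 D (n + 1) Y'‖ * diamWeight phi d₁ (univ.image Y') ≤ E)
    (hND : ∀ y', ∑ Y' ∈ univ.filter (fun Y' : Fin (n + 1) → Γ₁' => Y' p = y'),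
      ‖kernel 𝕜 D (n + 1) Y'‖ * diamWeight phi d₁ (univ.image Y') ≤ ND) :
    ∑ X' ∈ univ.filter (fun X' : Fin (n + 1) → Γ₂' => X' p = w'),
        ‖kernel 𝕜 (ExteriorAlgebra.map (Matrix.toLin' T') D) (n + 1) X'‖ * diamWeight phi d₂ (univ.image X') ≤
      a ^ n * (a * E + τ * ND) := by
  classical
  set Xp := univ.filter (fun X' : Fin (n + 1) → Γ₂' => X' p = w') with hXp
  have hphi0 : ∀ s, 0 ≤ s → 0 ≤ phi s := fun s hs => zero_le_one.trans (hphi1 s hs)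
  -- pointwise: `‖kernel (map T′ D) X′‖·W₂(X′) ≤ Σ_{Y′} (‖D Y′‖ W₁(Y′)) · ∏ (‖T′‖ φ(dc))`
  have hpt : ∀ X' : Fin (n + 1) → Γ₂',
      ‖kernel 𝕜 (ExteriorAlgebra.map (Matrix.toLin' T') D) (n + 1) X'‖ * diamWeight phi d₂ (univ.image X') ≤
        ∑ Y' : Fin (n + 1) → Γ₁', (‖kernel 𝕜 D (n + 1) Y'‖ * diamWeight phi d₁ (univ.image Y')) *
          ∏ i, (‖T' (X' i) (Y' i)‖ * phi (dc (X' i) (Y' i))) := by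
    intro X'
    have hW2 : 0 ≤ diamWeight phi d₂ (univ.image X') := hphi0 _ (labelDiam_nonneg _ _)
    rw [kernel_map]
    simp only [LinearMap.toMatrix'_toLin']
    calc ‖∑ Y' : Fin (n + 1) → Γ₁', (∏ i, T' (X' i) (Y' i)) * kernel 𝕜 D (n + 1) Y'‖ * diamWeight phi d₂ (univ.image X')
        ≤ (∑ Y' : Fin (n + 1) → Γ₁', ‖(∏ i, T' (X' i) (Y' i)) * kernel 𝕜 D (n + 1) Y'‖) * diamWeight phi d₂ (univ.image X') :=
          mul_le_mul_of_nonneg_right (norm_sum_le _ _) hW2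
      _ = ∑ Y' : Fin (n + 1) → Γ₁', ‖kernel 𝕜 D (n + 1) Y'‖ * (∏ i, ‖T' (X' i) (Y' i)‖) * diamWeight phi d₂ (univ.image X') := by
          rw [sum_mul]
          exact sum_congr rfl fun Y' _ => by rw [norm_mul, norm_prod]; ring
      _ ≤ ∑ Y' : Fin (n + 1) → Γ₁', ‖kernel 𝕜 D (n + 1) Y'‖ * (∏ i, ‖T' (X' i) (Y' i)‖) *
            (diamWeight phi d₁ (univ.image Y') * ∏ i, phi (dc (X' i) (Y' i))) :=
          sum_le_sum fun Y' _ => mul_le_mul_of_nonneg_left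
            (diamWeight_image_le_mul_prod hd₂ hdc0 hcross hphi1 hphimono hphisub X' Y')
            (mul_nonneg (norm_nonneg _) (prod_nonneg fun i _ => norm_nonneg _))
      _ = ∑ Y' : Fin (n + 1) → Γ₁', (‖kernel 𝕜 D (n + 1) Y'‖ * diamWeight phi d₁ (univ.image Y')) *
            ∏ i, (‖T' (X' i) (Y' i)‖ * phi (dc (X' i) (Y' i))) :=
          sum_congr rfl fun Y' _ => by rw [prod_mul_distrib]; ring
  -- the pinned out-sum factorises
  have hX : ∀ Y' : Fin (n + 1) → Γ₁', ∑ X' ∈ Xp, ∏ i, (‖T' (X' i) (Y' i)‖ * phi (dc (X' i) (Y' i))) ≤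
      (‖T' w' (Y' p)‖ * phi (dc w' (Y' p))) * a ^ n := by
    intro Y'
    rw [hXp, sum_pinned_prod_eq (fun i x => ‖T' x (Y' i)‖ * phi (dc x (Y' i))) p w']
    refine mul_le_mul_of_nonneg_left ?_ (mul_nonneg (norm_nonneg _) (hphi0 _ (hdc0 _ _)))
    calc ∏ i ∈ univ.erase p, ∑ x, ‖T' x (Y' i)‖ * phi (dc x (Y' i)) ≤ a ^ (univ.erase p).card :=
          prod_le_pow_card_of_le _ _ (fun i _ => sum_nonneg fun x _ => mul_nonneg (norm_nonneg _) (hphi0 _ (hdc0 _ _)))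
            fun i _ => hcol (Y' i)
      _ = a ^ n := by rw [card_univ_erase_fin]
  -- the pin row against the two profiles
  have hpin : ∑ Y' : Fin (n + 1) → Γ₁', (‖kernel 𝕜 D (n + 1) Y'‖ * diamWeight phi d₁ (univ.image Y')) *
      (‖T' w' (Y' p)‖ * phi (dc w' (Y' p))) ≤ a * E + τ * ND := by
    rw [sum_mul_apply_leg_eq (fun Y' => ‖kernel 𝕜 D (n + 1) Y'‖ * diamWeight phi d₁ (univ.image Y'))
      (fun y' => ‖T' w' y'‖ * phi (dc w' y')) p, ← sum_filter_add_sum_filter_not univ (fun y' : Γ₁' => Near y')]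
    have hg : ∀ y', 0 ≤ ‖T' w' y'‖ * phi (dc w' y') := fun y' => mul_nonneg (norm_nonneg _) (hphi0 _ (hdc0 _ _))
    refine add_le_add ?_ ?_
    · calc ∑ y' ∈ univ.filter (fun y' : Γ₁' => Near y'), ‖T' w' y'‖ * phi (dc w' y') *
            ∑ Y' ∈ univ.filter (fun Y' : Fin (n + 1) → Γ₁' => Y' p = y'), ‖kernel 𝕜 D (n + 1) Y'‖ * diamWeight phi d₁ (univ.image Y')
          ≤ ∑ y' ∈ univ.filter (fun y' : Γ₁' => Near y'), ‖T' w' y'‖ * phi (dc w' y') * E :=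
            sum_le_sum fun y' hy' => mul_le_mul_of_nonneg_left (hE y' (mem_filter.1 hy').2) (hg y')
        _ = (∑ y' ∈ univ.filter (fun y' : Γ₁' => Near y'), ‖T' w' y'‖ * phi (dc w' y')) * E := by rw [sum_mul]
        _ ≤ a * E := mul_le_mul_of_nonneg_right hrow hE0
    · calc ∑ y' ∈ univ.filter (fun y' : Γ₁' => ¬ Near y'), ‖T' w' y'‖ * phi (dc w' y') *
            ∑ Y' ∈ univ.filter (fun Y' : Fin (n + 1) → Γ₁' => Y' p = y'), ‖kernel 𝕜 D (n + 1) Y'‖ * diamWeight phi d₁ (univ.image Y')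
          ≤ ∑ y' ∈ univ.filter (fun y' : Γ₁' => ¬ Near y'), ‖T' w' y'‖ * phi (dc w' y') * ND :=
            sum_le_sum fun y' _ => mul_le_mul_of_nonneg_left (hND y') (hg y')
        _ = (∑ y' ∈ univ.filter (fun y' : Γ₁' => ¬ Near y'), ‖T' w' y'‖ * phi (dc w' y')) * ND := by rw [sum_mul]
        _ ≤ τ * ND := mul_le_mul_of_nonneg_right hτ hND0
  have hF0 : ∀ Y' : Fin (n + 1) → Γ₁', 0 ≤ ‖kernel 𝕜 D (n + 1) Y'‖ * diamWeight phi d₁ (univ.image Y') :=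
    fun Y' => mul_nonneg (norm_nonneg _) (hphi0 _ (labelDiam_nonneg _ _))
  calc ∑ X' ∈ Xp, ‖kernel 𝕜 (ExteriorAlgebra.map (Matrix.toLin' T') D) (n + 1) X'‖ * diamWeight phi d₂ (univ.image X')
      ≤ ∑ X' ∈ Xp, ∑ Y' : Fin (n + 1) → Γ₁', (‖kernel 𝕜 D (n + 1) Y'‖ * diamWeight phi d₁ (univ.image Y')) *
          ∏ i, (‖T' (X' i) (Y' i)‖ * phi (dc (X' i) (Y' i))) := sum_le_sum fun X' _ => hpt X'
    _ = ∑ Y' : Fin (n + 1) → Γ₁', (‖kernel 𝕜 D (n + 1) Y'‖ * diamWeight phi d₁ (univ.image Y')) *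
          ∑ X' ∈ Xp, ∏ i, (‖T' (X' i) (Y' i)‖ * phi (dc (X' i) (Y' i))) := by
        rw [sum_comm]; exact sum_congr rfl fun Y' _ => (mul_sum _ _ _).symm
    _ ≤ ∑ Y' : Fin (n + 1) → Γ₁', (‖kernel 𝕜 D (n + 1) Y'‖ * diamWeight phi d₁ (univ.image Y')) *
          ((‖T' w' (Y' p)‖ * phi (dc w' (Y' p))) * a ^ n) :=
        sum_le_sum fun Y' _ => mul_le_mul_of_nonneg_left (hX Y') (hF0 Y')
    _ = a ^ n * ∑ Y' : Fin (n + 1) → Γ₁', (‖kernel 𝕜 D (n + 1) Y'‖ * diamWeight phi d₁ (univ.image Y')) *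
          (‖T' w' (Y' p)‖ * phi (dc w' (Y' p))) := by
        rw [mul_sum]; exact sum_congr rfl fun Y' _ => by ring
    _ ≤ a ^ n * (a * E + τ * ND) := mul_le_mul_of_nonneg_left hpin (pow_nonneg ha n)

/-- **THE DIAMETER-WEIGHTED PUSHFORWARD** (no near region): `Σ_{X′ : X′_p = w′} ‖kernel (map T′ D) (n+1) X′‖·φ(diam_{d₂} X′) ≤ aⁿ·(a·ND)` for
`φ(dc)`-weighted column sums and pin row `≤ a` and `φ(diam_{d₁})`-weighted pinned profile `≤ ND` — the STEP's `hNV`/`hND` inputs at scale `j+1` from the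
scale-`j` one-volume weighted profiles and the weighted masses of the re-sectorisation kernel. [folklore] -/
theorem sum_pinned_wt_norm_kernel_map_le (T' : Matrix Γ₂' Γ₁' 𝕜) (D : GrassmannAlgebra 𝕜 Γ₁') {n : ℕ} (p : Fin (n + 1)) (w' : Γ₂')
    {d₁ : Γ₁' → Γ₁' → ℝ} {d₂ : Γ₂' → Γ₂' → ℝ} (hd₂ : IsLabelDist d₂) {dc : Γ₂' → Γ₁' → ℝ} (hdc0 : ∀ x y, 0 ≤ dc x y)
    (hcross : ∀ x x' y y', d₂ x x' ≤ dc x y + d₁ y y' + dc x' y') {phi : ℝ → ℝ} (hphi1 : ∀ s, 0 ≤ s → 1 ≤ phi s)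
    (hphimono : ∀ s t, 0 ≤ s → s ≤ t → phi s ≤ phi t) (hphisub : ∀ s t, 0 ≤ s → 0 ≤ t → phi (s + t) ≤ phi s * phi t)
    {a ND : ℝ} (ha : 0 ≤ a) (hND0 : 0 ≤ ND)
    (hcol : ∀ y', ∑ x', ‖T' x' y'‖ * phi (dc x' y') ≤ a) (hrow : ∑ y', ‖T' w' y'‖ * phi (dc w' y') ≤ a)
    (hND : ∀ y', ∑ Y' ∈ univ.filter (fun Y' : Fin (n + 1) → Γ₁' => Y' p = y'),
      ‖kernel 𝕜 D (n + 1) Y'‖ * diamWeight phi d₁ (univ.image Y') ≤ ND) :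
    ∑ X' ∈ univ.filter (fun X' : Fin (n + 1) → Γ₂' => X' p = w'),
        ‖kernel 𝕜 (ExteriorAlgebra.map (Matrix.toLin' T') D) (n + 1) X'‖ * diamWeight phi d₂ (univ.image X') ≤
      a ^ n * (a * ND) := by
  classical
  have h := sum_pinned_wt_norm_kernel_map_le_of_near T' D p w' hd₂ hdc0 hcross hphi1 hphimono hphisub (fun _ => True) (τ := 0)
    ha hND0 hND0 hcol (by rw [filter_true_of_mem fun _ _ => trivial]; exact hrow)
    (by rw [filter_false_of_mem fun _ _ => not_not_intro trivial, sum_empty]) (fun y' _ => hND y') hND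
  simpa only [zero_mul, add_zero] using h

end Summit.HubbardSuperconductivity.HubbardSuperconductivity.Theorems.TwoVolumeDefect

end
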